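import Mathlib
import Summits.ValiantsHypothesis.ValiantsHypothesis.Theorems.BarrierLeverDefinableEquationsDefs
import Literature.Computability.AlgebraicComplexity.RazUniversalCircuits

/-!
# Crux `BarrierLever.DefinableEquations` (stmt-8745) / `SingleSizeEquations` (stmt-8749) — the
# CLASS side in combinatorial form: Raz's map has NATURAL-NUMBER coefficients, so "E vanishes on
# the image of Γ" is a linear system on the coefficient function of `E` with coefficients in `ℕ`
# (val-np-p5 g7)

Companion to the explicit-coefficient normal form (`…CoefficientFunctionCrux.lean`): there the
EQUATION side of the crux became a coefficient function `φ = coeff E`; here the CLASS side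
(`{top(f) : L(f) ≤ n^b}` ⊆ image of Raz's universal-circuit map `Γ`, `stub_razTopUniversality`) is
unfolded.  Raz's generic output `OUT ∈ (R[Y])[Z]` is built from the leaves `z_t` by `Y`-weighted
sums and products with coefficients `0/1` only, uniformly in the coefficient semiring `R`:

* `RazIntegrality.map_base`, `map_out`, `map_uCoeff` — the construction commutes with every
  semiring map `R → S`; hence `uCoeff ℂ e = map ℕ→ℂ (uCoeff ℕ e)`: **every coordinate `Γ_e` of
  Raz's map is a polynomial in the labels with NATURAL-NUMBER coefficients**
  (`coeff_uCoeff_natCast`; combinatorially: `coeff_κ Γ_e` counts the monomial computation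
  trees of the universal graph with leaf multiset `e` and edge-label multiset `κ`).
* `RazIntegrality.eval_razPoint_forall_eq_zero_iff` — for `E ∈ ℂ[topMonomials n]`:
  `E` vanishes on the whole image `razPoint n b` of `Γ` **iff** for every label exponent `κ`
  `∑_{m ∈ supp E} coeff_m E · N_b(m, κ) = 0`, where
  `N_b(m, κ) = coeff_κ ∏_e Γ_e^{m_e} ∈ ℕ` (computed over `ℕ` and cast).

So, combined with `definableEquations_iff_explicitCoefficients`, the crux reads: find, uniformly in
`b`, a NONZERO `#P`-at-scale-`N`-explicit `φ` in the kernel of the nonnegative integer matrix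
`(N_b(m, κ))_{κ, m}` (one row per label exponent `κ` of degree `≤ D(2n-1)`, one column per exponent
vector `m` of degree `≤ D`).  Every row has only nonnegative entries, so a solution must change
sign inside every row support it meets — the natural home for sign-reversing-involution
constructions.  Pure bookkeeping over the tree's `RazUniversal`; no definitions, no named facts;
the crux stays OPEN.  Refs: R. Raz, Theory of Computing 6 (2010), Props. 2.8, 3.2, §3.2.
-/

set_option linter.dupNamespace false

noncomputable section

namespace Summit.ValiantsHypothesis.ValiantsHypothesis.Theorems.BarrierLeverDefinableEquations

open MvPolynomial Literature.Computability.AlgebraicComplexity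
open Literature.Barriers.ValiantsHypothesis
open scoped BigOperators

namespace RazIntegrality

open RazUniversal

section Map

variable {R S : Type*} [CommSemiring R] [CommSemiring S] (f : R →+* S)
  {σ : Type*} [Fintype σ] {r W : ℕ}

/-- Raz's node polynomials commute with semiring maps: `map (map f) (base_R d b) = base_S d b`.
[cite: Raz2010, Prop. 2.8 (p. 154)] -/
theorem map_base : ∀ (k : ℕ) (d : Fin (r + 1)), (d : ℕ) = k → ∀ b : BIdx σ r W,
    MvPolynomial.map (MvPolynomial.map f) (base (R := R) d b) = base (R := S) d b := by
  intro k
  induction k using Nat.strong_induction_on with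
  | _ k ih =>
    rintro d rfl b
    rcases b with t | ⟨j, c⟩
    · conv_lhs => rw [base]
      conv_rhs => rw [base]
      split_ifs
      · exact map_X _ _
      · exact map_zero _
    · conv_lhs => rw [base]
      conv_rhs => rw [base]
      split_ifs with h
      · rw [map_mul, map_sum, map_sum]
        congr 1
        · refine Finset.sum_congr rfl fun b _ => ?_
          rw [map_mul, map_C, MvPolynomial.map_X, ih (j : ℕ) h.2 (Fin.castSucc j) rfl b]
        · refine Finset.sum_congr rfl fun b _ => ?_
          rw [map_mul, map_C, MvPolynomial.map_X,
            ih ((d : ℕ) - j) (by omega) ⟨(d : ℕ) - j, by have := d.isLt; omega⟩ rfl b]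
      · exact map_zero _

/-- The generic output commutes with semiring maps. [cite: Raz2010, §3.2 (p. 157)] -/
theorem map_out : MvPolynomial.map (MvPolynomial.map f) (out R σ r W) = out S σ r W := by
  unfold out
  rw [map_sum]
  refine Finset.sum_congr rfl fun b _ => ?_
  rw [map_mul, map_C, MvPolynomial.map_X, map_base f r (Fin.last r) rfl b]

/-- The coordinates of Raz's map commute with semiring maps: `map f (Γ_e over R) = Γ_e over S`.
[cite: Raz2010, §3.2 (p. 157)] -/
theorem map_uCoeff (e : σ →₀ ℕ) :
    MvPolynomial.map f (uCoeff R σ r W e) = uCoeff S σ r W e := by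
  unfold uCoeff
  rw [← coeff_map, map_out]

end Map

variable {σ : Type*} [Fintype σ] {r W : ℕ}

/-- **Raz's map has natural-number coefficients**: every coefficient of every coordinate `Γ_e`
over `ℂ` is the cast of the corresponding coefficient over `ℕ`. [cite: Raz2010, §3.2 (p. 157)] -/
theorem coeff_uCoeff_natCast (e : σ →₀ ℕ) (κ : Lab σ r W →₀ ℕ) :
    coeff κ (uCoeff ℂ σ r W e) = ((coeff κ (uCoeff ℕ σ r W e) : ℕ) : ℂ) := by
  rw [← map_uCoeff (Nat.castRingHom ℂ) e, coeff_map]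
  rfl

/-- The same for products of powers of coordinates: the `κ`-coefficient of `∏_e Γ_e^{m_e}` over `ℂ`
is the cast of a natural number (the entry `N(m, κ)` of the constraint matrix).
[cite: Raz2010, §3.2 (p. 157)] -/
theorem coeff_prod_uCoeff_natCast (m : ↥(topMonomials r) →₀ ℕ) (κ : Lab (Fin r) r W →₀ ℕ) :
    coeff κ (m.prod fun e k => uCoeff ℂ (Fin r) r W (e : Fin r →₀ ℕ) ^ k) =
      ((coeff κ (m.prod fun e k => uCoeff ℕ (Fin r) r W (e : Fin r →₀ ℕ) ^ k) : ℕ) : ℂ) := by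
  have h : (m.prod fun e k => uCoeff ℂ (Fin r) r W (e : Fin r →₀ ℕ) ^ k) =
      MvPolynomial.map (Nat.castRingHom ℂ)
        (m.prod fun e k => uCoeff ℕ (Fin r) r W (e : Fin r →₀ ℕ) ^ k) := by
    rw [Finsupp.prod, Finsupp.prod, map_prod]
    refine Finset.prod_congr rfl fun e _ => ?_
    rw [map_pow, map_uCoeff]
  rw [h, coeff_map]
  rfl

/-- **The vanishing condition as a linear system over `ℕ`.**  A polynomial `E` in the top
coefficient variables vanishes on the whole image `razPoint n b` of Raz's map iff, for every
label exponent `κ`, `∑_{m ∈ supp E} coeff_m E · N_b(m, κ) = 0` with the NATURAL numbers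
`N_b(m, κ) = coeff_κ ∏_e Γ_e^{m_e}` (computed over `ℕ`). [cite: Raz2010, §3.2 (p. 157)] -/
theorem eval_razPoint_forall_eq_zero_iff {n b : ℕ} (E : MvPolynomial ↥(topMonomials n) ℂ) :
    (∀ y : Lab (Fin n) n (razSlots n b) → ℂ, eval (razPoint n b y) E = 0) ↔
      ∀ κ : Lab (Fin n) n (razSlots n b) →₀ ℕ,
        ∑ m ∈ E.support, coeff m E *
          ((coeff κ (m.prod fun e k =>
            uCoeff ℕ (Fin n) n (razSlots n b) (e : Fin n →₀ ℕ) ^ k) : ℕ) : ℂ) = 0 := by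
  classical
  -- `E(Γ(y)) = (E ∘ Γ)(y)` and `E ∘ Γ = 0` iff all its coefficients vanish
  have hcomp : ∀ y : Lab (Fin n) n (razSlots n b) → ℂ, eval (razPoint n b y) E =
      eval y (aeval (fun e : topMonomials n =>
        uCoeff ℂ (Fin n) n (razSlots n b) (e : Fin n →₀ ℕ)) E) := fun y => by
    rw [aeval_eq_bind₁, show eval y (bind₁ (fun e : topMonomials n =>
        uCoeff ℂ (Fin n) n (razSlots n b) (e : Fin n →₀ ℕ)) E) =
        eval₂Hom (RingHom.id ℂ) y (bind₁ (fun e : topMonomials n =>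
          uCoeff ℂ (Fin n) n (razSlots n b) (e : Fin n →₀ ℕ)) E) from rfl, eval₂Hom_bind₁]
    rfl
  have hzero : (∀ y : Lab (Fin n) n (razSlots n b) → ℂ, eval (razPoint n b y) E = 0) ↔
      aeval (fun e : topMonomials n => uCoeff ℂ (Fin n) n (razSlots n b) (e : Fin n →₀ ℕ)) E
        = 0 := by
    constructor
    · intro h
      refine MvPolynomial.funext fun y => ?_
      rw [← hcomp, h y, map_zero]
    · intro h y
      rw [hcomp, h, map_zero]
  rw [hzero, MvPolynomial.ext_iff]
  refine forall_congr' fun κ => ?_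
  rw [coeff_zero]
  -- expand `E ∘ Γ` along the monomials of `E`
  conv_lhs => rw [E.as_sum, map_sum, coeff_sum]
  have hterm : ∀ m ∈ E.support, coeff κ (aeval (fun e : topMonomials n =>
      uCoeff ℂ (Fin n) n (razSlots n b) (e : Fin n →₀ ℕ)) (monomial m (coeff m E))) =
      coeff m E * ((coeff κ (m.prod fun e k =>
        uCoeff ℕ (Fin n) n (razSlots n b) (e : Fin n →₀ ℕ) ^ k) : ℕ) : ℂ) := by
    intro m _
    rw [aeval_monomial, algebraMap_eq, coeff_C_mul, coeff_prod_uCoeff_natCast]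
  rw [Finset.sum_congr rfl hterm]

end RazIntegrality

end Summit.ValiantsHypothesis.ValiantsHypothesis.Theorems.BarrierLeverDefinableEquations

end
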